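import Mathlib
import Literature.AlgebraicGeometry.Resolution.CobordantGame
import Literature.AlgebraicGeometry.Resolution.CobordantChartCoefficients
import Literature.AlgebraicGeometry.Resolution.CobordantTupleGame
import Literature.AlgebraicGeometry.Resolution.FormalCoordinateChange
import Summits.ResolutionOfSingularities.ResolutionOfSingularities.Theorems.WeightedInvariantGlobalizeLocalDropCanonize
import Summits.ResolutionOfSingularities.ResolutionOfSingularities.Theorems.WeightedInvariantLocalWeightedDropTangentConeCut
import Summits.ResolutionOfSingularities.ResolutionOfSingularities.Theorems.WeightedInvariantLocalWeightedDropMonicPointBlowup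
import Summits.ResolutionOfSingularities.ResolutionOfSingularities.Theorems.WeightedInvariantLocalWeightedDropMonicCurveBlowup
import Summits.ResolutionOfSingularities.ResolutionOfSingularities.Theorems.WeightedInvariantLocalWeightedDropMonicRecentre
import Summits.ResolutionOfSingularities.ResolutionOfSingularities.Theorems.WeightedInvariantLocalWeightedDropCharTwoDoublePointReduction

/-!
# `WeightedInvariant.LocalWeightedDrop`, line `hasse-ridge-face-selection`: the LIFT for monic double points (N3 at `d = 2`)

Crux item stmt-ResolutionOfSingularities-8899 `LocalWeightedDrop` (route `ResolutionOfSingularities/WeightedInvariant`),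
serving the door `WeightedConstruction` stmt-ResolutionOfSingularities-0571.  [OURS · L1 W4.3, chain w43, stub worker 3:
helper N3 of CRUX-PLAN w43 §3C at `d = 2`, for the piece S2 `stub_charTwoDoublePointSurfaceWon` of skeleton v19.  Not a
statement of any manuscript.]

`monicDoublePointsWon_of_rank`: the wild (`d = 2`) analogue of `stub_multiplicityLift`.  POSITIONS are the monic double points
`y² + A₁(x') y + A₀(x')`, `ord A₀ ≥ 3`, `ord A₁ ≥ 2` (`WeierstrassForm`, `CharTwoDoublePointMonic`: S2 ⟺ all positions won);
MOVES are the three landed bricks — re-centring `y ↦ y + φ(x')` (`won_monic_two_recentre_iff`), the point blow-up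
(`won_monic_of_pointBlowup`) and the permissible curve blow-ups `V(x_i, y)` (`won_monic_of_curveBlowup`); the EXITS are the
hyperbolic tangent quadric (`TangentConeCut.hyperbolicStartsWon`, needs only the germs in `n + 1` variables) and non-singular
slices.  THE THEOREM: if an ordinal rank `κ(A₀, A₁)` has the STEP PROPERTY — from every position the rank player names a
re-centring and a brick such that every singular slice either exits hyperbolically or RE-NORMALISES (`S ∘ M = H · position′`,
data supplied by the rank player) to a position of smaller rank — then every position is won.  Proof: well-founded induction
on `κ`, exactly as in the tame lift.

What remains for S2 (over `k̄`, characteristic `2`, `n = 0`) is N4: a rank with the step property — the char-`2` surface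
double-point descent (CJS LNM 2270 Ch. 13–14 / Hauser–Perlega), for which the tree already holds the Literature-level polygon
laws (CRUX-PLAN v0.2 (w3)).  No wild point ever has to be visited: the bricks use weight-`1` moves only, whose `γ ≠ 0`
successors are units.
-/

set_option linter.dupNamespace false -- mandated namespace of this single-conjunct summit

namespace Summit.ResolutionOfSingularities.ResolutionOfSingularities.Theorems

open Literature.AlgebraicGeometry.Resolution
open Literature.AlgebraicGeometry.Resolution.CobordantGame

namespace MonicDoublePointLift

open MvPowerSeries

variable {k : Type} [Field k] {m : ℕ}

/-- The two spellings of a monic double point: `y² + (A₀ + A₁ y) = y² + Σ_{j<2} A_j y^j`. -/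
theorem monic_two_eq_sum (A₀ A₁ : MvPowerSeries (Fin m) k) :
    X (Fin.last m) ^ 2 + (rename (Fin.succAboveEmb (Fin.last m)) A₀ + rename (Fin.succAboveEmb (Fin.last m)) A₁ * X (Fin.last m)) =
      X (Fin.last m) ^ 2 + ∑ j : Fin 2, rename (Fin.succAboveEmb (Fin.last m))
        ((![A₀, A₁] : Fin 2 → MvPowerSeries (Fin m) k) j) * X (Fin.last m) ^ (j : ℕ) := by
  rw [Fin.sum_univ_two]
  simp

/-- … and back: `y² + Σ_{j<2} B_j y^j = y² + (B 0 + B 1 · y)`. -/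
theorem sum_two_eq_monic (B : Fin 2 → MvPowerSeries (Fin m) k) :
    X (Fin.last m) ^ 2 + ∑ j : Fin 2, rename (Fin.succAboveEmb (Fin.last m)) (B j) * X (Fin.last m) ^ (j : ℕ) =
      X (Fin.last m) ^ 2 + (rename (Fin.succAboveEmb (Fin.last m)) (B 0) +
        rename (Fin.succAboveEmb (Fin.last m)) (B 1) * X (Fin.last m)) := by
  rw [Fin.sum_univ_two]
  simp


end MonicDoublePointLift

open MonicDoublePointLift MvPowerSeries in
/-- N3 AT `d = 2` — THE LIFT FOR MONIC DOUBLE POINTS (every characteristic `p`, `N = n + 3` variables, `k` any field of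
characteristic `p`).  Suppose every singular germ in `n + 1` variables is won (`hlow`; for surfaces, `n = 0`: germs in one
variable) and there is an ordinal RANK `κ` on the pairs `(A₀, A₁)` with the STEP PROPERTY `hstep`: from every position
(`ord A₀ ≥ 3`, `ord A₁ ≥ 2`) the rank player names a re-centring `φ` (keeping the position shape) and then EITHER the point
blow-up OR a permissible curve blow-up `V(x_i, y)` (with its divisibility data), such that every SINGULAR slice `S` produced by
the corresponding landed brick (`won_monic_of_pointBlowup` / `won_monic_of_curveBlowup`, slices spelled verbatim) is GOOD:
either it carries a hyperbolic-quadric witness (the hypothesis shape of `TangentConeCut.hyperbolicStartsWon`), or the rank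
player re-normalises it — `S ∘ M = H · (y² + A₀' + A₁' y)` with `M` invertible, `H(0) ≠ 0`, `ord A₀' ≥ 3`, `ord A₁' ≥ 2` — to a
position of SMALLER RANK.  Then every monic double point `y² + A₁ y + A₀` (`ord A₀ ≥ 3`, `ord A₁ ≥ 2`) is won.
(Well-founded induction on `κ`; `won_monic_two_recentre_iff`, the two bricks, `hyperbolicStartsWon`, `won_unit_mul_iff`,
`won_subst_iff`.)  With `CharTwoDoublePointMonic.charTwoDoublePointSurfaceWon_of_monicForms` (`n = 0`, `p = 2`) this reduces
CORE W″ piece S2 to the existence of such a rank on pairs `(A₀, A₁) ∈ k[[x₁,x₂]]²` — N4, the char-`2` surface descent. -/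
theorem monicDoublePointsWon_of_rank (p : ℕ) (hp : p.Prime) (k : Type) [Field k] [CharP k p] (n : ℕ)
    (hlow : ∀ g : MvPowerSeries (Fin (n + 1)) k, CobordantGame.IsSingular k g → CobordantGame.Won k (n + 1) g)
    (κ : MvPowerSeries (Fin (n + 2)) k → MvPowerSeries (Fin (n + 2)) k → Ordinal.{0})
    (hstep : ∀ A₀ A₁ : MvPowerSeries (Fin (n + 2)) k, (2 : ℕ∞) < A₀.order → (1 : ℕ∞) < A₁.order →
      ∃ φ : MvPowerSeries (Fin (n + 2)) k, MvPowerSeries.constantCoeff φ = 0 ∧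
        (2 : ℕ∞) < (A₀ + A₁ * φ + φ ^ 2).order ∧ (1 : ℕ∞) < (A₁ + 2 * φ).order ∧
        let good : MvPowerSeries (Fin (n + 3)) k → Prop := fun S =>
          (∃ θ : Fin (n + 3) → MvPowerSeries (Fin (n + 3)) k, (∀ i, MvPowerSeries.constantCoeff (θ i) = 0) ∧
            IsUnit (Matrix.det (Matrix.of fun i j => MvPowerSeries.coeff (Finsupp.single j 1) (θ i))) ∧
            MvPowerSeries.coeff (Finsupp.single 0 2) (MvPowerSeries.subst θ S) = 0 ∧
            MvPowerSeries.coeff (Finsupp.single 1 2) (MvPowerSeries.subst θ S) = 0 ∧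
            MvPowerSeries.coeff (Finsupp.single 0 1 + Finsupp.single 1 1) (MvPowerSeries.subst θ S) ≠ 0) ∨
          (∃ (M : Matrix (Fin (n + 3)) (Fin (n + 3)) k) (H : MvPowerSeries (Fin (n + 3)) k)
              (A₀' A₁' : MvPowerSeries (Fin (n + 2)) k),
            IsUnit M.det ∧ MvPowerSeries.constantCoeff H ≠ 0 ∧ (2 : ℕ∞) < A₀'.order ∧ (1 : ℕ∞) < A₁'.order ∧
            MvPowerSeries.subst (FormalCoordChange.linSubst M) S =
              H * (MvPowerSeries.X (Fin.last (n + 2)) ^ 2 +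
                (MvPowerSeries.rename (Fin.succAboveEmb (Fin.last (n + 2))) A₀' +
                  MvPowerSeries.rename (Fin.succAboveEmb (Fin.last (n + 2))) A₁' * MvPowerSeries.X (Fin.last (n + 2)))) ∧
            κ A₀' A₁' < κ A₀ A₁)
        ((∀ (c : Fin (n + 2) → k) (i₀ : Fin (n + 2)), c i₀ ≠ 0 → ∀ Bv : Fin 2 → MvPowerSeries (Fin (n + 3)) k,
            (∀ j : Fin 2, MvPowerSeries.subst (CobordantChart.chart (fun _ : Fin (n + 2) => 1) c)
              ((![A₀ + A₁ * φ + φ ^ 2, A₁ + 2 * φ] : Fin 2 → MvPowerSeries (Fin (n + 2)) k) j) =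
              MvPowerSeries.X 0 ^ (2 - (j : ℕ) + 1) * Bv j) →
            ∀ S : MvPowerSeries (Fin (n + 3)) k, S = MvPowerSeries.X (Fin.last (n + 2)) ^ 2 +
              ∑ j : Fin 2, MvPowerSeries.rename (Fin.succAboveEmb (Fin.last (n + 2)))
                (TupleGame.slice i₀ (MvPowerSeries.X 0 * Bv j)) * MvPowerSeries.X (Fin.last (n + 2)) ^ (j : ℕ) →
            CobordantGame.IsSingular k S → good S) ∨
         (∃ (i : Fin (n + 2)) (A' : Fin 2 → MvPowerSeries (Fin (n + 2)) k),
            (∀ j : Fin 2, ((![A₀ + A₁ * φ + φ ^ 2, A₁ + 2 * φ] : Fin 2 → MvPowerSeries (Fin (n + 2)) k) j) =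
              MvPowerSeries.X i ^ (2 - (j : ℕ)) * A' j) ∧
            (∀ j : Fin 2, MvPowerSeries.constantCoeff (A' j) = 0) ∧
            ∀ ci : k, ci ≠ 0 → ∀ S : MvPowerSeries (Fin (n + 3)) k, S = MvPowerSeries.X (Fin.last (n + 2)) ^ 2 +
              ∑ j : Fin 2, MvPowerSeries.rename (Fin.succAboveEmb (Fin.last (n + 2)))
                (MvPowerSeries.C (ci ^ (2 - (j : ℕ))) * TupleGame.slice i
                  (MvPowerSeries.subst (CobordantChart.chart (fun l : Fin (n + 2) => if l = i then 1 else 0)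
                    (fun l : Fin (n + 2) => if l = i then ci else 0)) (A' j))) *
                MvPowerSeries.X (Fin.last (n + 2)) ^ (j : ℕ) →
              CobordantGame.IsSingular k S → good S))) :
    ∀ A₀ A₁ : MvPowerSeries (Fin (n + 2)) k, (2 : ℕ∞) < A₀.order → (1 : ℕ∞) < A₁.order →
      CobordantGame.Won k (n + 3) (MvPowerSeries.X (Fin.last (n + 2)) ^ 2 +
        (MvPowerSeries.rename (Fin.succAboveEmb (Fin.last (n + 2))) A₀ +
          MvPowerSeries.rename (Fin.succAboveEmb (Fin.last (n + 2))) A₁ * MvPowerSeries.X (Fin.last (n + 2)))) := by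
  classical
  suffices key : ∀ (α : Ordinal.{0}) (A₀ A₁ : MvPowerSeries (Fin (n + 2)) k), κ A₀ A₁ = α →
      (2 : ℕ∞) < A₀.order → (1 : ℕ∞) < A₁.order →
      Won k (n + 3) (X (Fin.last (n + 2)) ^ 2 + (rename (Fin.succAboveEmb (Fin.last (n + 2))) A₀ +
        rename (Fin.succAboveEmb (Fin.last (n + 2))) A₁ * X (Fin.last (n + 2)))) from
    fun A₀ A₁ h₀ h₁ => key _ A₀ A₁ rfl h₀ h₁
  intro α
  induction α using WellFoundedLT.induction with
  | ind α ih =>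
  intro A₀ A₁ hα hA₀ hA₁
  obtain ⟨φ, hφ, hB₀, hB₁, hbr⟩ := hstep A₀ A₁ hA₀ hA₁
  -- re-centre
  rw [← won_monic_two_recentre_iff φ hφ A₀ A₁]
  set B₀ := A₀ + A₁ * φ + φ ^ 2 with hB₀def
  set B₁ := A₁ + 2 * φ with hB₁def
  -- a good singular slice is won
  have hgood : ∀ S : MvPowerSeries (Fin (n + 3)) k, IsSingular k S →
      ((∃ θ : Fin (n + 3) → MvPowerSeries (Fin (n + 3)) k, (∀ i, constantCoeff (θ i) = 0) ∧
          IsUnit (Matrix.det (Matrix.of fun i j => coeff (Finsupp.single j 1) (θ i))) ∧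
          coeff (Finsupp.single 0 2) (subst θ S) = 0 ∧ coeff (Finsupp.single 1 2) (subst θ S) = 0 ∧
          coeff (Finsupp.single 0 1 + Finsupp.single 1 1) (subst θ S) ≠ 0) ∨
        (∃ (M : Matrix (Fin (n + 3)) (Fin (n + 3)) k) (H : MvPowerSeries (Fin (n + 3)) k)
            (A₀' A₁' : MvPowerSeries (Fin (n + 2)) k),
          IsUnit M.det ∧ constantCoeff H ≠ 0 ∧ (2 : ℕ∞) < A₀'.order ∧ (1 : ℕ∞) < A₁'.order ∧
          subst (FormalCoordChange.linSubst M) S = H * (X (Fin.last (n + 2)) ^ 2 +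
            (rename (Fin.succAboveEmb (Fin.last (n + 2))) A₀' +
              rename (Fin.succAboveEmb (Fin.last (n + 2))) A₁' * X (Fin.last (n + 2)))) ∧
          κ A₀' A₁' < κ A₀ A₁)) →
      Won k (n + 3) S := by
    intro S hS hgoodS
    rcases hgoodS with hhyp | ⟨M, H, A₀', A₁', hMdet, hH, hA₀', hA₁', hSeq, hlt⟩
    · exact TangentConeCut.hyperbolicStartsWon hlow S hS hhyp
    · have hW' := ih _ (hα ▸ hlt) A₀' A₁' rfl hA₀' hA₁'
      have hW : Won k (n + 3) (subst (FormalCoordChange.linSubst M) S) := by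
        rw [hSeq]
        exact (won_unit_mul_iff hH _).mpr hW'
      exact (won_subst_iff (ConeDichotomy.constantCoeff_linSubst M)
        (by rw [CharTwoDoublePoint.linMat_linSubst]; exact hMdet) S).mp hW
  have hAv : ∀ j : Fin 2, ((2 - (j : ℕ) : ℕ) : ℕ∞) < (((![B₀, B₁] : Fin 2 → MvPowerSeries (Fin (n + 2)) k) j)).order := by
    intro j
    fin_cases j
    · simpa using hB₀
    · simpa using hB₁
  rw [monic_two_eq_sum]
  rcases hbr with hpoint | ⟨i, A', hdiv, hA'0, hcurve⟩
  · -- the point blow-up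
    refine won_monic_of_pointBlowup p hp k (n + 2) 2 two_pos (![B₀, B₁]) hAv fun c i₀ hc Bv hBv hSs => ?_
    exact hgood _ hSs (hpoint c i₀ hc Bv hBv _ rfl hSs)
  · -- the curve blow-up along `V(x_i, y)`
    refine won_monic_of_curveBlowup p hp k (n + 2) 2 two_pos i (![B₀, B₁]) A' hdiv hA'0 fun ci hci hSs => ?_
    exact hgood _ hSs (hcurve ci hci _ rfl hSs)


end Summit.ResolutionOfSingularities.ResolutionOfSingularities.Theorems
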